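import Summits.SmoothPoincare4.SmoothPoincare4.Theses.SymplecticOrigami
import Summits.SmoothPoincare4.SmoothPoincare4.Theorems.OrigamiFoldExistence.Negative.ZeroSlack
import Literature.Topology.FourManifolds.HomotopySpheres
import Literature.Topology.FourManifolds.HomotopyS4CompactProofs
import Literature.Topology.FourManifolds.HomotopyS4OrientableProofs

/-!
# Skeleton line `shadow-pleats` for crux `OrigamiFoldExistence` (stmt-SmoothPoincare4-7844)

Route `SymplecticOrigami`, crux r4 `OrigamiFoldExistence` (E; ZERO SLACK: kernel-checked both ways,
`Disproof.lean` §2 / `Negative.ZeroSlack`, so every line for E is a line for `Σ ≅ S⁴` followed by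
transport of the round sphere's fold data).  Idea card `Ideas/shadow-pleats.md` (crux-ideate r1,
ideator 2); triage r1-2 PASS (with doubt) + r1-3 PASS, three sharpenings, all adopted below.

THE LINE.  Read the fold data EXTRINSICALLY.  Every homotopy 4-sphere `Σ` embeds in
`ℝ⁵ = ℂ² × ℝ` (`Θ₄ = 0`), and for `Σ ⊂ ℂ² × ℝ` the SHADOW MAP `φ = proj5 ∘ ι : Σ → ℝ⁴` (forget the
height `h = p 4`) is an equidimensional map whose singular set is the locus of VERTICAL TANGENCY of
`Σ`; on the round `S⁴` it is the fold along the equator, and `φ*ω₀` is Cannas da Silva–Guillemin–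
Pires' origami form (arXiv:0909.4065 Ex. 2.3, tree `sphereOrigamiForm`).  Put a chart ball of `Σ` in
ROUND position: `ι(Σ) ∩ {h ≤ 1 - δ} = S⁴ ∩ {h ≤ 1 - δ}` (the whole round sphere except a polar cap,
so the equatorial fold and the lower sheet are standard and the fake 4-disc `Δ = ι⁻¹{h ≥ 1 - δ}`
hangs above the plane `h = 1 - δ`, attached along the polar circle where the sphere is graphical).
Eliashberg–Mishachev's h-principle for EMBEDDINGS INTO FOLIATIONS (arXiv:1108.1265 =
doi:10.1090/conm/498/09753, Thm 3.2 with Remark 2 (relative) and the final Remark of §3.2 (double-fold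
version via Thm 2.10 "int-tang-global-folds"), codimension `q = 4 ≤ n = 4`, foliation of `ℝ⁵` by
vertical lines) then isotopes `Δ` rel its collar, `C⁰`-small, to a position whose only vertical
tangencies are FOLDS along finitely many pairs of 3-spheres bounding annuli `S³ × I` — PLEATS
(spherical double folds) — each born from an embryo at a point (ibid. §3.2 D(b)), hence with
STANDARD annulus and STANDARD hole inside a chart ball.  The formal hypothesis of the h-principle is
the vanishing of the relative Gauss degree of `Δ` into `(S⁴, open upper hemisphere)`, which is
`deg G_Σ − deg G_cap = χ(Σ)/2 − 1 = 0` for EVERY `Σ` (triage r1-2/r1-3 re-derived it).  So every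
`Σ` has a PLEATED ROUND-RIM POSITION with some number `k` of pleats (`stub_roundRimNormalForm`), and
the least such `k` is the PLEAT NUMBER `p(Σ)`.  The ladder: `p = 0 ⇒ Σ ≅ S⁴` by sheet counting and an
explicit graph-straightening diffeomorphism, no Cerf (`stub_pleatFreeStandard`); `p = 1 ⇒ p = 0`
(ONE-PLEAT IRONING, `stub_onePleatIroning`); `p = 2 ⇒ p ≤ 1` (UN-THREADING two pleats, the card's
first honest rung K1, `stub_twoPleatUnthreading`); and PLEAT COLLAPSE `p ≤ 2` for every `Σ`
(`stub_pleatCollapse`, the card's K2 — the zero-slack carrier of this line, HARDEST).  Step zero,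
`Σ ↪ ℝ⁵`, is VERBATIM the support item `EmbedsInR5` of route AlgebraicDegree (stmt-SmoothPoincare4-3403),
so it is staffed once (`stub_embedsInR5`).

`OrigamiFoldExistence_of` composes the six stubs with the LANDED transport lemma
`Negative.foldData_transport` (p72874) and the route's own support item `RoundSphereIsOrigamiFold`
(by name, hypothesis `hR`, exactly as in `Lines/round-trace-continuity.lean`) into the crux BY NAME;
kernel-checked, no `sorry` outside the six `stub_*`; the packaging "homotopy S⁴ ⇒ compact /
orientable" is the PROVED pair `compactSpace_of_homotopyEquiv_sphere_four_holds`,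
`isOrientable_of_homotopyEquiv_sphere_four_holds`.

TYPING (all over Mathlib; no new objects are posited).  A pleated position is the predicate
`IsPleatedPosition ι δ e`: `ι : M → ℝ⁵` a `C^∞` embedding; `0 < δ < 1` and
`range ι ∩ {h ≤ 1 - δ} = S⁴ ∩ {h ≤ 1 - δ}` (round part, containing the equatorial fold); `k` PLEAT
CHARTS `e j : ℝ⁴ ↪ M` (smooth embeddings of the whole model space) landing strictly above the plane,
whose FOLD SPHERES are the round spheres of radii 1 and 2 of the chart — so the annulus
`e j {1 ≤ |u| ≤ 2} ≅ S³ × I` and the hole `e j {|u| < 1} ≅ B⁴` are standard BY CONSTRUCTION (triage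
r1-2 "define p over STANDARD pleats", r1-3 sharpen (2) "source annulus ≅ S³ × I"; this is what
excludes the doubles `D(B) = Σ_B # Σ̄_B` of Schoenflies balls from the one-pleat rung); fold spheres
of distinct pleats are disjoint (NESTING inside another pleat's annulus or hole is allowed, as E–M
produce it); the shadow `proj5 ∘ ι` is an immersion at every point above the plane off the fold
spheres; and at each fold-sphere point the shadow has a FOLD: `IsFoldPointAt G u` = corank-1 point
of `G = proj5 ∘ ι ∘ e j : ℝ⁴ → ℝ⁴` whose intrinsic second derivative `ker × ker → coker` is non-zero
(Whitney; for the shadow of a hypersurface this is `II(∂_h, ∂_h) ≠ 0`: the vertical tangent is not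
asymptotic), written with `fderiv` in the pleat chart, where it is coordinate-free.  The spun
shadows `{h² = f(x)}` of the card's `SpunShadowStandard` are the `k = 0` positions up to the
graph-straightening of `stub_pleatFreeStandard` (triage r1-3 sharpen (1), `0 < f` on the open ball,
is moot: no defining function is quantified any more).  NON-VACUITY of the fold clause is PROVED in
this file (`ModelFold.isFoldPointAt_modelFold`, sorry-free): Whitney's model fold
`u ↦ (u₀², u₁, u₂, u₃)` satisfies `IsFoldPointAt` at the origin (kernel `e₀`,
`D²G(0)[e₀,e₀] = 2e₀ ∉ range dG(0)`); the 0-pleat position of the round sphere is recorded as the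
statement `RoundSphereIsPleatFree` for refuters.

Disproof used (Disproof.lean v3, read 2026-08-16): §1 LOAD-BEARING — any proof must use `M ≃ₕ S⁴`
including CONNECTEDNESS (`crux_false_without_homotopyEquiv`, `Negative.LoadBearing` p73838,
`Negative.Disconnected` p74343): this line uses compactness + connectedness of `M` at
`stub_pleatFreeStandard` (properness of the glued shadow map and triviality of the covering it
defines) and `H₃(Δ) = 0`, `χ(Σ) = 2` at `stub_roundRimNormalForm` (fold spheres separate; Gauss
degree); §2 ZERO SLACK — honoured: the line ends in `Negative.foldData_transport` (landed) exactly as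
§2 prescribes, and its zero-slack step is NAMED (`stub_pleatCollapse`); §4 no refuted strengthening
bears on pleats; §7 targets are the other line's stubs.  `ledger negatives --problem SmoothPoincare4`
= 0; no landed `Negative/` lemma refutes an instance of any stub (the three landed ones are
`ZeroSlack`, `LoadBearing`, `Disconnected`, all imported or importable here).
-/

noncomputable section

-- the prescribed namespace `Summit.<P>.<Sub>.…` duplicates `SmoothPoincare4` (P = Sub)
set_option linter.dupNamespace false

open scoped Manifold ContDiff Topology
open Set Function TopologicalSpace ContinuousMap
open Literature.Topology.FourManifolds (HomotopySphere)
open Summit.SmoothPoincare4.SmoothPoincare4.Theses.SymplecticOrigami (OrigamiFoldExistence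
  RoundSphereIsOrigamiFold)
open Summit.SmoothPoincare4.SmoothPoincare4.Theorems.OrigamiFoldExistence (Negative.foldData_transport)

namespace Summit.SmoothPoincare4.SmoothPoincare4.Cruxes.OrigamiFoldExistence.ShadowPleats

/-- Local notation: the model space `ℝ⁴ = ℂ²` (coordinates `p 0, …, p 3`). -/
local notation "E4" => EuclideanSpace ℝ (Fin 4)

/-- Local notation: `ℝ⁵ = ℂ² × ℝ`, height coordinate `p 4`. -/
local notation "E5" => EuclideanSpace ℝ (Fin 5)

/-- Local notation: the round 4-sphere with Mathlib's smooth structure. -/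
local notation "𝕊⁴" => (Metric.sphere (0 : EuclideanSpace ℝ (Fin 5)) 1)

/-! ### Vocabulary (plain definitions over Mathlib) -/

/-- The SHADOW: vertical projection `ℂ² × ℝ → ℂ²`, forgetting the height `p 4`.  For an embedding
`ι : M ↪ ℝ⁵` the shadow map is `proj5 ∘ ι : M → ℝ⁴`; its singular points are the vertical
tangencies of `ι(M)` (`∂_h ∈ Tι(M)`), and the kernel there is automatically one-dimensional
(`ker d(proj5 ∘ ι) = dι⁻¹(ℝ ∂_h)`). -/
def proj5 (p : E5) : E4 :=
  WithLp.toLp 2 ![p 0, p 1, p 2, p 3]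

/-- The two FOLD SPHERES of a pleat chart: the round spheres of radii `1` and `2` in the model
`ℝ⁴` of the chart (so the pleat's annulus is the shell `1 ≤ |u| ≤ 2 ≅ S³ × I` and its hole is the
unit ball — both standard by construction). -/
def pleatSpheres : Set E4 :=
  Metric.sphere (0 : E4) 1 ∪ Metric.sphere (0 : E4) 2

/-- `u` is a FOLD POINT of the smooth map `G : ℝ⁴ → ℝ⁴` (Whitney): `dG(u)` has a non-zero kernel
vector `v` (corank exactly one in every use below, where `G` is the shadow of an immersion into
`ℝ⁵`) and the INTRINSIC SECOND DERIVATIVE `ker × ker → coker`, `(v, v) ↦ D²G(u)[v, v] mod range dG(u)`,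
is non-zero.  This is coordinate-free (source changes add `dG(D²ψ[v,v]) ∈ range`, target changes act
linearly on `coker`), and for a corank-one germ it is exactly the fold condition: in adapted
coordinates `G(t, y) = (γ(t, y), y)` with `γ_t(0) = 0` it reads `γ_tt(0) ≠ 0`, which gives both
`j¹G ⋔ Σ¹` and `ker dG ⋔ TΣ¹(G)`.  For the shadow of a hypersurface `Σ ⊂ ℝ⁴ × ℝ` at a vertical
tangency it is `⟨n, D²ι[v,v]⟩ = II(∂_h, ∂_h) ≠ 0` (the unit normal `n` is horizontal there and spans
the cokernel).  Degenerate junk is excluded: if `G` is not differentiable at `u` then `fderiv = 0`,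
the second derivative is `0 ∈ range`, and the predicate is FALSE. -/
def IsFoldPointAt (G : E4 → E4) (u : E4) : Prop :=
  ∃ v : E4, v ≠ 0 ∧ fderiv ℝ G u v = 0 ∧
    fderiv ℝ (fun w => fderiv ℝ G w v) u v ∉ LinearMap.range (fderiv ℝ G u).toLinearMap

/-- A PLEATED ROUND-RIM SHADOW POSITION of `M` in `ℝ⁵ = ℂ² × ℝ` with `k` pleats.
* `ι : M → ℝ⁵` is a `C^∞` embedding;
* ROUND PART: `0 < δ < 1` and `range ι ∩ {h ≤ 1 - δ} = S⁴ ∩ {h ≤ 1 - δ}` — below the plane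
  `h = 1 - δ` the image IS the round unit sphere (lower sheet, equatorial fold `h = 0`, and the
  graphical band up to the polar circle of radius `√(2δ - δ²)`), and nothing else of `ι(M)` reaches
  down to that closed half-space; the fake 4-disc `Δ = ι⁻¹{h ≥ 1 - δ}` is attached along the polar
  circle, where `S⁴` is graphical over `ℂ²`;
* PLEAT CHARTS: each `e j : ℝ⁴ → M` is a smooth embedding of the whole model space landing strictly
  above the plane (inside `Δ°`); its fold spheres `e j '' pleatSpheres` are disjoint from those of
  the other pleats (nesting in another pleat's annulus `e i {1 < |u| < 2}` or hole `e i {|u| < 1}` is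
  allowed);
* SHADOW: `proj5 ∘ ι` has injective differential at every point above the plane off the fold
  spheres (one graphical sheet locally), and a FOLD (`IsFoldPointAt`, in the chart `e j`) at every
  point of every fold sphere.
So the vertical tangencies of `ι(M)` are exactly: the round equator, and `2k` three-spheres paired
into `k` standard pleats.  `k = 0` with `ι` the inclusion of `S⁴` and `δ = 1/2` is an instance
(sanity); E–M's theorem produces instances for every homotopy 4-sphere (`RoundRimNormalForm`). -/
def IsPleatedPosition {M : Type} [TopologicalSpace M] [ChartedSpace E4 M] (ι : M → E5) (δ : ℝ)
    {k : ℕ} (e : Fin k → E4 → M) : Prop :=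
  Manifold.IsSmoothEmbedding (𝓡 4) (𝓡 5) ∞ ι ∧ 0 < δ ∧ δ < 1 ∧
    Set.range ι ∩ {p : E5 | p 4 ≤ 1 - δ} = (𝕊⁴ : Set E5) ∩ {p : E5 | p 4 ≤ 1 - δ} ∧
    (∀ j, Manifold.IsSmoothEmbedding (𝓡 4) (𝓡 4) ∞ (e j) ∧ ∀ u : E4, 1 - δ < ι (e j u) 4) ∧
    Pairwise (Function.onFun Disjoint fun j => e j '' pleatSpheres) ∧
    (∀ m : M, 1 - δ < ι m 4 → m ∉ (⋃ j, e j '' pleatSpheres) →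
      Function.Injective (mfderiv (𝓡 4) (𝓡 4) (proj5 ∘ ι) m)) ∧
    (∀ j, ∀ u ∈ pleatSpheres, IsFoldPointAt (proj5 ∘ ι ∘ e j) u)

/-- `M` admits a pleated round-rim shadow position with (exactly) `k` pleat charts.  The PLEAT
NUMBER `p(M)` of the card is the least such `k` (not needed as a definition: the stubs are
implications between these existence statements). -/
def HasPleatedPosition (M : Type) [TopologicalSpace M] [ChartedSpace E4 M] (k : ℕ) : Prop :=
  ∃ (ι : M → E5) (δ : ℝ) (e : Fin k → E4 → M), IsPleatedPosition ι δ e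

/-! ### The six stub STATEMENTS (named `Prop`s; the registered `stub_*` theorems below restate them
verbatim, and `Registered.stub_*` are their name-keyed aliases used as the hypotheses of
`OrigamiFoldExistence_of` — same device as `Lines/round-trace-continuity.lean`) -/

/-- Statement of STUB 1 [Σ ↪ ℝ⁵] — VERBATIM the support item `EmbedsInR5` of route AlgebraicDegree
(stmt-SmoothPoincare4-3403). -/
def EmbedsInR5 : Prop :=
  ∀ S : Literature.Topology.FourManifolds.HomotopySphere 4, ∃ e : S.carrier → EuclideanSpace ℝ (Fin 5), Manifold.IsSmoothEmbedding (𝓡 4) (𝓡 5) ∞ e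

/-- Statement of STUB 2 [ROUND-RIM NORMAL FORM, Eliashberg–Mishachev]: an embedded homotopy
4-sphere in `ℝ⁵` can be re-embedded in pleated round-rim position. -/
def RoundRimNormalForm : Prop :=
  ∀ (M : Type) [TopologicalSpace M] [T2Space M] [SecondCountableTopology M] [ChartedSpace E4 M]
    [IsManifold (𝓡 4) ∞ M] (ι₀ : M → E5), M ≃ₕ 𝕊⁴ →
    Manifold.IsSmoothEmbedding (𝓡 4) (𝓡 5) ∞ ι₀ → ∃ k, HasPleatedPosition M k

/-- Statement of STUB 3 [PLEAT COLLAPSE, hardest, zero slack]: `p(Σ) ≤ 2`. -/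
def PleatCollapse : Prop :=
  ∀ (M : Type) [TopologicalSpace M] [T2Space M] [SecondCountableTopology M] [ChartedSpace E4 M]
    [IsManifold (𝓡 4) ∞ M], M ≃ₕ 𝕊⁴ →
    ∀ k, HasPleatedPosition M k → ∃ k', k' ≤ 2 ∧ HasPleatedPosition M k'

/-- Statement of STUB 4 [TWO-PLEAT UN-THREADING, the card's rung K1]: `p ≤ 2 ⇒ p ≤ 1`. -/
def TwoPleatUnthreading : Prop :=
  ∀ (M : Type) [TopologicalSpace M] [T2Space M] [SecondCountableTopology M] [ChartedSpace E4 M]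
    [IsManifold (𝓡 4) ∞ M], M ≃ₕ 𝕊⁴ →
    HasPleatedPosition M 2 → ∃ k, k ≤ 1 ∧ HasPleatedPosition M k

/-- Statement of STUB 5 [ONE-PLEAT IRONING, the card's P2]: `p ≤ 1 ⇒ p = 0`. -/
def OnePleatIroning : Prop :=
  ∀ (M : Type) [TopologicalSpace M] [T2Space M] [SecondCountableTopology M] [ChartedSpace E4 M]
    [IsManifold (𝓡 4) ∞ M], M ≃ₕ 𝕊⁴ →
    HasPleatedPosition M 1 → HasPleatedPosition M 0

/-- Statement of STUB 6 [PLEAT-FREE ⇒ STANDARD, the card's P1 in round-rim form]: `p = 0 ⇒ Σ ≅ S⁴`. -/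
def PleatFreeStandard : Prop :=
  ∀ (M : Type) [TopologicalSpace M] [T2Space M] [SecondCountableTopology M] [ChartedSpace E4 M]
    [IsManifold (𝓡 4) ∞ M], M ≃ₕ 𝕊⁴ →
    HasPleatedPosition M 0 → Nonempty (M ≃ₘ⟮𝓡 4, 𝓡 4⟯ 𝕊⁴)

/-! ### The registered stubs -/

/-- STUB 1 [Σ ↪ ℝ⁵] (L; a THEOREM; SHARED verbatim with route AlgebraicDegree's support item
`EmbedsInR5`, stmt-SmoothPoincare4-3403, so it is staffed once).  Every homotopy 4-sphere embeds
smoothly in `ℝ⁵`: `Σ` is h-cobordant to `S⁴` (Kervaire–Milnor 1963, `Θ₄ = 0` as h-cobordism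
classes; tree named fact `Literature.Topology.FourManifolds.isHCobordant_sphere_of_homotopySphere_four`),
so `Σ = ∂W` for a compact contractible `W⁵` (cap the h-cobordism with `D⁵`); `W × I` is a
contractible 6-manifold with simply connected boundary, hence `D⁶` (Smale), so the double
`D(W) = ∂(W × I) ≅ S⁵` and `Σ ⊂ S⁵ ∖ pt = ℝ⁵`.  Why it might fail: it cannot (theorem); formally it
waits on the `Θ₄ = 0` fact and the 6-dimensional h-cobordism theorem.  Sources:
KervaireMilnorAnnals1963 (Thm 1.1, table p. 504); MilnorHCobordism1965 (§9); Smale1962.  Size: L. -/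
theorem stub_embedsInR5 :
    ∀ S : Literature.Topology.FourManifolds.HomotopySphere 4, ∃ e : S.carrier → EuclideanSpace ℝ (Fin 5), Manifold.IsSmoothEmbedding (𝓡 4) (𝓡 5) ∞ e := by
  sorry

/-- STUB 2 [ROUND-RIM NORMAL FORM] (XL as a formal task; IN PRINT modulo assembly — the card's P3,
triage-checked).  Given a smooth embedding `ι₀ : M ↪ ℝ⁵` of a homotopy 4-sphere, `M` admits a
pleated round-rim shadow position (`HasPleatedPosition M k` for some `k`).  Proof in print:
(i) ROUND PART — move a chart 4-disc of `ι₀(M)` onto `S⁴ ∩ {h ≤ 1 - δ}` by an ambient isotopy of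
`ℝ⁵` (Palais 1960: smooth discs in a connected manifold are ambient isotopic), then PUSH UP the rest:
the flow of `ψ ∂_h` (`ψ` a cut-off vanishing near the round part, `= 1` away from it) for a long
time carries `Δ = M ∖ round part` into `{h > 1 - δ}` rel its collar (the collar is the polar band
of `S⁴`, already above the plane), so WLOG `range ι ∩ {h ≤ 1 - δ} = S⁴ ∩ {h ≤ 1 - δ}`;
(ii) FORMAL DATUM — the Gauss map `G : Δ → S⁴` rel collar has relative degree into
`(S⁴, open upper hemisphere)` equal to `deg G_Σ − (contribution of the round part over a downward
normal) = χ(Σ)/2 − 1 = 0` (Hopf), so `G|Δ` is homotopic rel collar to a map into the open upper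
hemisphere, i.e. there is a tangential rotation of `Δ`, fixed near the collar, ending transversal to
the vertical line foliation `𝓕` of `ℝ⁵` (`codim 𝓕 = 4 = dim Δ`);
(iii) H-PRINCIPLE — Eliashberg–Mishachev, Wrinkled embeddings (arXiv:1108.1265 =
doi:10.1090/conm/498/09753), Thm 3.2 "Embeddings into foliations" (`codim 𝓕 = q ≤ n`; here the base
case `q̄ = 1` of its inductive proof, §3.2 D(a): wrinkle by Thm 2.2, then `𝓕`-regularise, Lemma
"F-regularization-1"), Remark 2 (relative to the collar), Remark 1 (`C⁰`-close, so the pleated `Δ`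
stays above the plane), in the DOUBLE-FOLD version (final Remark of §3.2: use Thm 2.10
"int-tang-global-folds" — folded embeddings with spherical double folds, cusps removed by Whitney
surgery, Props 2.11–2.12 — instead of Thm 2.2): the new `Δ` has fold-type tangency to `𝓕` (§3.3
Whitney–Thom definition = `IsFoldPointAt` of the shadow) exactly along finitely many pairs of
3-spheres bounding annuli `S³ × I`, possibly nested, and is transversal to `𝓕` elsewhere;
(iv) PACKAGING — "each wrinkle originates from embryo (i.e. from a point)" (§3.2 D(b)) inside a
simplex of a fine triangulation (§2.8), and cusp surgery is local, so each pleat's annulus and hole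
are the standard shell and ball of a chart `e j : ℝ⁴ ↪ Δ°` after reparametrising the chart
(equivariant tubular neighbourhoods of the two fold spheres: the fold involution is conjugate to the
radial reflection), giving `IsPleatedPosition`.  Why plausibly true: (i)–(iv) are theorems; the only
reading risks are the one-sentence double-fold Remark at `q = n` (triage r1-2 flagged, r1-3 could not
re-run it; the base case of E–M's induction IS the equidimensional one, so the Remark applies
verbatim) and the chart packaging (iv).  Why it might fail: only through (iv) — if some E–M pleat
could not be charted with ROUND concentric fold spheres (it can: explicit model), the definition
would have to allow diffeomorphic images of the shell.  Sources: EliashbergMishachev2009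
(arXiv:1108.1265) Thm 3.2 + Rem 1–2 + §3.2 final Remark, Thm 2.10, §2.3, §3.3; Eliashberg1972
(surgery of singularities); Palais1960; Hopf1927 (`deg G = χ/2`); MilnorTopologyDifferentiable1965.
Size: XL (no h-principle in the tree; to be vendored as a cite fact "E–M Thm 3.2, double-fold,
relative, q = n = 4"). -/
theorem stub_roundRimNormalForm :
    ∀ (M : Type) [TopologicalSpace M] [T2Space M] [SecondCountableTopology M] [ChartedSpace E4 M]
      [IsManifold (𝓡 4) ∞ M] (ι₀ : M → E5), M ≃ₕ 𝕊⁴ →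
      Manifold.IsSmoothEmbedding (𝓡 4) (𝓡 5) ∞ ι₀ → ∃ k, HasPleatedPosition M k := by
  sorry

/-- STUB 3 [PLEAT COLLAPSE] — HARDEST, the zero-slack carrier of the line (the card's K2): every
homotopy 4-sphere with a pleated round-rim position has one with AT MOST TWO pleats.  Given stubs
4–6 it is EQUIVALENT to SPC4 (Disproof §2: `crux_iff_smoothPoincare4`; conversely `M ≅ S⁴`
trivially has a 0-pleat position), so no evidence beyond SPC4 ⇒ it exists; what the line offers is
a MECHANISM and a bench.  Mechanism (card): a pleated position is a finite configuration — `k`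
standard pleats (each a `Z`-profile `× S³` over its shell at creation) whose only interaction is
THREADING (a sheet of one pleat, or of the main sheet, passing through the slot of another over
the overlap of their shadows in `ℂ²`); isotopies of `ι(M)` cross codimension-one walls where a sheet
enters or leaves a slot (quadruple vertical alignments, births/deaths in the 4-parameter family of
0-dimensional sections `ι(M) ∩` vertical line), and pleats are born/die in embryos (E–M §2.10,
model `(y, z) ↦ (y, z³, z⁵)`); the claim is that a complexity (number of pleats, then total
threading) can be driven down to `k ≤ 2` by such moves.  BENCH (triage r1-2 sharpen): the normal
form of STUB 2 applies verbatim to spun homology spheres `S(Y) ⊂ ℝ⁵` (`χ = 2`, same degree count),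
which by stubs 4–6 (true for any closed `M` in place of a homotopy sphere as far as their proofs
go) can NEVER reach `k ≤ 2`; so any move set proving this stub must use `π₁(M) = 1` (beyond
`H_* = H_*(S⁴)`), and a proposed π₁-blind un-threading calculus is refuted by running it on `S(Y)`.
Why it might fail: zero slack — an exotic `S⁴` refutes it; E–M goffering produces pleats densely
(`C⁰`-closeness forces `k → ∞`, ibid. §2.7) with uncontrolled mutual threading, and no monotone
quantity on pleat configurations is known; reducing `k` is the whole smooth problem.  Sources:
EliashbergMishachev2009 (arXiv:1108.1265) §2.7, §2.10, Thm 3.2; EliashbergMishachev2000 (Wrinkling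
II/III); route WrinkleUnlinking `DepthTwoCollapse` (stmt-SmoothPoincare4-10373, the analogous
collapse for wrinkled MAPS `Σ → S⁴`); Disproof.lean §2.  Size: open-problem. -/
theorem stub_pleatCollapse :
    ∀ (M : Type) [TopologicalSpace M] [T2Space M] [SecondCountableTopology M] [ChartedSpace E4 M]
      [IsManifold (𝓡 4) ∞ M], M ≃ₕ 𝕊⁴ →
      ∀ k, HasPleatedPosition M k → ∃ k', k' ≤ 2 ∧ HasPleatedPosition M k' := by
  sorry

/-- STUB 4 [TWO-PLEAT UN-THREADING] (the card's rung K1 — the first honest rung; L / open): a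
homotopy 4-sphere with a 2-pleat round-rim position has one with at most one pleat.
Configurations: the two pleat charts are un-nested, nested (pleat 2 inside the annulus of pleat 1)
or pleat 2 inside the hole of pleat 1; in each case the source decomposes as
`Δ = P ∪ (annuli, holes: standard)` and all three regions are immersed in `ℂ²` by the shadow with
fold seams.  Card mechanism: over the overlap of the two shells in `ℂ²` a sheet of one pleat can
pass through the slot of the other (THREADING); the slot of each pleat contains at most one foreign
sheet, the 4-parameter family of vertical sections has a cancellable pair, and sliding the foreign
sheet out of the slot (an isotopy of `ι(M)` in `ℝ⁵` supported over the overlap) separates the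
shadows, after which one pleat dies in an embryo or is ironed as in STUB 5.  Why plausibly true:
two standard local objects and one interaction; the analogous rung for wrinkled MAPS
(WrinkleUnlinking `TwoWrinkleRung`, stmt-SmoothPoincare4-10371) reduces to one clasped pair by a
parking argument, and here the target `ℂ²` carries heights that order the sheets.  Why it might
fail: a foreign sheet inside a slot is a properly embedded 4-disc in a 5-dimensional slab rel
boundary, one dimension up from Budney–Gabai's knotted 3-balls in `S⁴`, so "slide it out" may
re-create tangencies; and the outer sheet `P` need not be embedded by the shadow (see STUB 5), so
the slot may contain sheets of `P` itself.  Bench: must FAIL for a 2-pleat position of a spun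
homology sphere `S(Y)` if such exists (cheapest falsifier of any π₁-blind proof).  Sources:
EliashbergMishachev2009 §2.10 (embryos of double folds); BudneyGabai2019 (arXiv:1912.09029);
route WrinkleUnlinking (TwoWrinkleRung, UnlinkingLemma); Haefliger1960 (lifting folds to
embeddings).  Size: L–open. -/
theorem stub_twoPleatUnthreading :
    ∀ (M : Type) [TopologicalSpace M] [T2Space M] [SecondCountableTopology M] [ChartedSpace E4 M]
      [IsManifold (𝓡 4) ∞ M], M ≃ₕ 𝕊⁴ →
      HasPleatedPosition M 2 → ∃ k, k ≤ 1 ∧ HasPleatedPosition M k := by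
  sorry

/-- STUB 5 [ONE-PLEAT IRONING] (the card's P2; M–L, with one genuinely open corner recorded
below).  A homotopy 4-sphere with a 1-pleat round-rim position has a pleat-free one.  Source
decomposition: `Δ = P ∪ e(shell) ∪ e(ball)` with the annulus `A = e{1 ≤ |u| ≤ 2} ≅ S³ × I` and the
hole `Q = e{|u| < 1} ≅ B⁴` STANDARD (definition), so `Σ ≅ S⁴ ⟺ P ≅ S³ × I`, `P = Δ ∖ e{|u| < 2}`
the outer region, an h-cobordism immersed in `ℂ²` by the shadow with the round polar collar at its
outer end and a fold seam into `A` at its inner end.  (a) FIBRED / GRAPHICAL CASE (triage r1-3 (c),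
re-derived): if the shadow EMBEDS each of `P`, `A`, `Q`, the rims `Rᵢ = proj5 (ι (e Sᵢ))` are
embedded 3-spheres in `ℂ²`, `proj5(Q)` is the Schoenflies ball of `R₁` and is standard because `Q`
is, `proj5(A) ≅ S³ × I` then makes the Schoenflies ball of `R₂` standard, and `P ≅ B⁴_ρ ∖ B_{R₂}`
is a product (Palais) — equivalently, iron the `Z`-profile fibrewise over the shell (card).
(b) GENERAL CASE: `P` is only IMMERSED (multi-sheeted over `ℂ²`; sheets of `P` may even pass through
the pleat's own slot), and (a) does not apply; what is needed is either an isotopy of `ι(M)`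
removing the pleat (fill the crease `c = shadow|e(S₂)` "straight through" by an immersed 4-ball with
the prescribed one-sided germ — a 4-dimensional Blank-type extension problem about STANDARD balls,
no exotica — then apply the covering lemma of STUB 6 to `P ∪ ball`), or a direct proof that the
immersed h-cobordism `P` with these two ends is a product.  Why plausibly true: all exoticness sits
in `P` while the constraint on `P` (graphical immersion rel BOTH ends: round collar outside, fold
into a standard pleat inside) is a codimension-0 immersion problem relative to the full boundary,
where h-principles fail (top relative handle) and rigidity of the round end can propagate, as it
does for `k = 0`; no 1-pleat position of a suspicious `Σ` is known.  Why it might fail: if every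
homotopy sphere of the form `Σ' # Σ̄'` (double of a fake ball) or some spun `S(Y)` admitted a 1-pleat
position, the stub would contain "inverses in the monoid of homotopy 4-spheres are trivial" or be
false — the chart-standard annulus excludes the obvious triple-layer construction (its middle sheet
would be the fake `P̄`, not `S³ × I`), but a cleverer one is the cheapest falsifier.  Sources:
Palais1960; Brown1960 / EuclideanOrigami `CoveringLemma` (stmt-SmoothPoincare4-7482); Blank1967 /
Poenaru (extension of immersions to the disc); Smale1959, Hirsch1959; triage r1-3 (c).  Size: M–L
(case (a) L formal; case (b) open corner). -/
theorem stub_onePleatIroning :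
    ∀ (M : Type) [TopologicalSpace M] [T2Space M] [SecondCountableTopology M] [ChartedSpace E4 M]
      [IsManifold (𝓡 4) ∞ M], M ≃ₕ 𝕊⁴ →
      HasPleatedPosition M 1 → HasPleatedPosition M 0 := by
  sorry

/-- STUB 6 [PLEAT-FREE ⇒ STANDARD] (M mathematically, L–XL formally; provable now; the card's P1 /
`SpunShadowStandard` in round-rim form, with NO Cerf `Γ₄`).  If `M ≃ₕ S⁴` has a 0-pleat round-rim
position then `M ≅ S⁴`.  Proof: `M` is compact (`compactSpace_of_homotopyEquiv_sphere_four_holds`)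
and connected; `1 - δ` is a regular value of `h ∘ ι` attained exactly on the polar circle (points at
height `≤ 1 - δ` lie on `S⁴`), so `Δ = ι⁻¹{h ≥ 1 - δ}` is a compact connected 4-manifold with
boundary the polar circle `S³_ρ`, `ρ = √(2δ - δ²) < 1`, and the shadow `g = proj5 ∘ ι` is an
immersion on all of `Δ` (above the plane by hypothesis; at the boundary because `Tι(M) = TS⁴` is
graphical there), embedding a collar of `∂Δ` onto a one-sided inner collar of the round `S³_ρ ⊂ ℂ²`
(first-order: on `TS⁴` at height `1 - δ`, `dh > 0 ⟺ d|x| < 0`).  SHEET COUNTING: glue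
`X = Δ ∪_{S³_ρ} (ℂ² ∖ B_ρ)` and `Φ = g ∪ id : X → ℂ²`; `Φ` is a proper local homeomorphism, hence a
covering of the simply connected `ℂ²` by the connected `X`, hence a homeomorphism; so `g|Δ` is
injective with image the closed ball `B̄_ρ` and `ι(Δ)` is the GRAPH `{(x, u(x))}` of a function
smooth on the open ball (this is EuclideanOrigami's `CoveringLemma`, stmt-SmoothPoincare4-7482,
proved pattern `exists_homeomorph_image_eq_sphereEquator_holds`).  STRAIGHTENING: `Ψ : M → S⁴`,
`Ψ = ι` on the round part and `Ψ = σ ∘ g` on `Δ`, `σ(x) = (x, √(1 - |x|²))` the inverse shadow chart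
of the polar cap (smooth on a neighbourhood of `B̄_ρ` since `ρ < 1` — this is why the round part is
required past the equator), agrees with `ι = σ ∘ g` near the seam, is a smooth bijection with smooth
inverse: `M ≅ S⁴`.  Uses exactly the Disproof's load-bearing hypotheses (compactness for properness,
connectedness for the one-sheeted covering).  Why it might fail: it cannot mathematically; formally
the covering-space step and the manifold-with-boundary bookkeeping of `Δ` are the work.  Sources:
Palais1960; Brown1960; GabaiNaylorSchwartz2025 (sheet counting); tree `CoveringLemma` /
`exists_homeomorph_image_eq_sphereEquator_holds`; CannasdasilvaGuilleminPires2010 Ex 2.3 (the model).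
Size: M (math) / L–XL (Lean). -/
theorem stub_pleatFreeStandard :
    ∀ (M : Type) [TopologicalSpace M] [T2Space M] [SecondCountableTopology M] [ChartedSpace E4 M]
      [IsManifold (𝓡 4) ∞ M], M ≃ₕ 𝕊⁴ →
      HasPleatedPosition M 0 → Nonempty (M ≃ₘ⟮𝓡 4, 𝓡 4⟯ 𝕊⁴) := by
  sorry

/-! ### Consistency: each named statement IS its registered stub (definitionally) -/

theorem embedsInR5_holds : EmbedsInR5 := stub_embedsInR5
theorem roundRimNormalForm_holds : RoundRimNormalForm := stub_roundRimNormalForm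
theorem pleatCollapse_holds : PleatCollapse := stub_pleatCollapse
theorem twoPleatUnthreading_holds : TwoPleatUnthreading := stub_twoPleatUnthreading
theorem onePleatIroning_holds : OnePleatIroning := stub_onePleatIroning
theorem pleatFreeStandard_holds : PleatFreeStandard := stub_pleatFreeStandard

/-! ### Name-keyed aliases of the six statements (the hypotheses of the composition) -/
namespace Registered

/-- Alias of `EmbedsInR5` keyed by the registered stub name. -/
abbrev stub_embedsInR5 : Prop := EmbedsInR5
/-- Alias of `RoundRimNormalForm` keyed by the registered stub name. -/
abbrev stub_roundRimNormalForm : Prop := RoundRimNormalForm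
/-- Alias of `PleatCollapse` keyed by the registered stub name. -/
abbrev stub_pleatCollapse : Prop := PleatCollapse
/-- Alias of `TwoPleatUnthreading` keyed by the registered stub name. -/
abbrev stub_twoPleatUnthreading : Prop := TwoPleatUnthreading
/-- Alias of `OnePleatIroning` keyed by the registered stub name. -/
abbrev stub_onePleatIroning : Prop := OnePleatIroning
/-- Alias of `PleatFreeStandard` keyed by the registered stub name. -/
abbrev stub_pleatFreeStandard : Prop := PleatFreeStandard

end Registered

/-! ### Glue (proved) -/

/-- The LOW RUNGS from STUBS 4–6: a position with at most two pleats already gives `M ≅ S⁴`. -/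
theorem nonempty_diffeomorph_of_le_two (h4 : TwoPleatUnthreading) (h5 : OnePleatIroning)
    (h6 : PleatFreeStandard) (M : Type) [TopologicalSpace M] [T2Space M]
    [SecondCountableTopology M] [ChartedSpace E4 M] [IsManifold (𝓡 4) ∞ M] (hM : M ≃ₕ 𝕊⁴)
    (k : ℕ) (hk : k ≤ 2) (hP : HasPleatedPosition M k) : Nonempty (M ≃ₘ⟮𝓡 4, 𝓡 4⟯ 𝕊⁴) := by
  -- the rungs `k ≤ 1`
  have h01 : ∀ j, j ≤ 1 → HasPleatedPosition M j → Nonempty (M ≃ₘ⟮𝓡 4, 𝓡 4⟯ 𝕊⁴) := by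
    intro j hj hQ
    interval_cases j
    · exact h6 M hM hQ
    · exact h6 M hM (h5 M hM hQ)
  interval_cases k
  · exact h01 0 (by norm_num) hP
  · exact h01 1 le_rfl hP
  · obtain ⟨j, hj, hQ⟩ := h4 M hM hP
    exact h01 j hj hQ

/-- The LADDER: embed (STUB 1) ⟶ normal form (STUB 2) ⟶ collapse to `k ≤ 2` (STUB 3) ⟶ low rungs
(STUBS 4–6) ⟶ `M ≅ S⁴`, for every `M ≃ₕ S⁴` with the summit's binders (compactness and
orientability of `M` are the PROVED tree theorems, used only to package `M` as a `HomotopySphere 4`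
for STUB 1). -/
theorem nonempty_diffeomorph_sphere_of (h1 : EmbedsInR5) (h2 : RoundRimNormalForm)
    (h3 : PleatCollapse) (h4 : TwoPleatUnthreading) (h5 : OnePleatIroning) (h6 : PleatFreeStandard)
    (M : Type) [TopologicalSpace M] [T2Space M] [SecondCountableTopology M] [ChartedSpace E4 M]
    [IsManifold (𝓡 4) ∞ M] (hM : M ≃ₕ 𝕊⁴) : Nonempty (M ≃ₘ⟮𝓡 4, 𝓡 4⟯ 𝕊⁴) := by
  haveI : CompactSpace M :=
    Literature.Topology.FourManifolds.compactSpace_of_homotopyEquiv_sphere_four_holds M hM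
  obtain ⟨o⟩ :=
    Literature.Topology.FourManifolds.isOrientable_of_homotopyEquiv_sphere_four_holds M hM
  obtain ⟨ι₀, hι₀⟩ := h1 ⟨M, o, ⟨hM⟩⟩
  obtain ⟨k, hk⟩ := h2 M ι₀ hM hι₀
  obtain ⟨k', hk'le, hk'⟩ := h3 M hM k hk
  exact nonempty_diffeomorph_of_le_two h4 h5 h6 M hM k' hk'le hk'

/-! ### The composition: the six stubs and the route item `RoundSphereIsOrigamiFold` imply the
crux, by name -/

/-- `OrigamiFoldExistence` from the six stubs and the route's support item
`RoundSphereIsOrigamiFold` (pure logic + PROVED theorems; no `sorry`): the ladder gives `M ≅ S⁴`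
for every `M ≃ₕ S⁴`; the fold data of `S⁴` transport along the diffeomorphism by the LANDED
`Negative.foldData_transport` (p72874). -/
theorem OrigamiFoldExistence_of (h1 : Registered.stub_embedsInR5)
    (h2 : Registered.stub_roundRimNormalForm) (h3 : Registered.stub_pleatCollapse)
    (h4 : Registered.stub_twoPleatUnthreading) (h5 : Registered.stub_onePleatIroning)
    (h6 : Registered.stub_pleatFreeStandard) (hR : RoundSphereIsOrigamiFold) :
    OrigamiFoldExistence := by
  intro M _ _ _ _ _ hM
  obtain ⟨Φ⟩ := nonempty_diffeomorph_sphere_of h1 h2 h3 h4 h5 h6 M hM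
  exact Negative.foldData_transport Φ hR

/-- Wiring check: the registered stubs feed `OrigamiFoldExistence_of` as stated. -/
example (hR : RoundSphereIsOrigamiFold) : OrigamiFoldExistence :=
  OrigamiFoldExistence_of stub_embedsInR5 stub_roundRimNormalForm stub_pleatCollapse
    stub_twoPleatUnthreading stub_onePleatIroning stub_pleatFreeStandard hR

/-! ### Sanity of the vocabulary (NOT stubs, not used in the composition) -/

/-- Recorded as a statement for the lead / refuters: the inclusion of the round sphere is a
0-pleat position with `δ = 1/2` (a refuter who cannot build it has found a definition leak). -/
def RoundSphereIsPleatFree : Prop :=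
  HasPleatedPosition 𝕊⁴ 0

/-! #### Non-vacuity of the fold clause (PROVED): the model fold `u ↦ (u₀², u₁, u₂, u₃)` of
Whitney satisfies `IsFoldPointAt` at the origin, with kernel vector `e₀`, `D²G(0)[e₀, e₀] = 2e₀ ∉
range dG(0) = {x | x 0 = 0}`. -/

namespace ModelFold

/-- The first basis vector `e₀` of `ℝ⁴`. -/
def e0 : E4 := EuclideanSpace.single (0 : Fin 4) (1 : ℝ)

/-- The coordinate `u ↦ u 0` as a continuous linear map. -/
def p0 : E4 →L[ℝ] ℝ := EuclideanSpace.proj (0 : Fin 4)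

/-- The linear part `h ↦ h - (h 0) • e₀` (zero out the first coordinate). -/
def Alin : E4 →L[ℝ] E4 := ContinuousLinearMap.id ℝ E4 - p0.smulRight e0

/-- The MODEL FOLD `u ↦ (u₀², u₁, u₂, u₃)`, written as `Alin u + (u 0)² • e₀`. -/
def modelFold (u : E4) : E4 := Alin u + (p0 u * p0 u) • e0

@[simp] lemma p0_apply (u : E4) : p0 u = u 0 := rfl

@[simp] lemma e0_apply_zero : e0 0 = 1 := by simp [e0]

@[simp] lemma p0_e0 : p0 e0 = 1 := by simp [p0, e0]

lemma Alin_e0 : Alin e0 = 0 := by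
  simp [Alin, ContinuousLinearMap.smulRight_apply]

/-- The derivative of the model fold: `dG(u) h = Alin h + 2 u₀ h₀ • e₀`. [folklore] -/
lemma hasFDerivAt_modelFold (u : E4) :
    HasFDerivAt modelFold (Alin + ((p0 u) • p0 + (p0 u) • p0).smulRight e0) u := by
  have hp : HasFDerivAt (fun w : E4 => p0 w) p0 u := p0.hasFDerivAt
  have hq : HasFDerivAt (fun w : E4 => p0 w * p0 w) ((p0 u) • p0 + (p0 u) • p0) u := hp.mul hp
  exact Alin.hasFDerivAt.add (hq.smul_const e0)

lemma fderiv_modelFold (u : E4) :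
    fderiv ℝ modelFold u = Alin + ((p0 u) • p0 + (p0 u) • p0).smulRight e0 :=
  (hasFDerivAt_modelFold u).fderiv

/-- **The fold clause is non-vacuous**: Whitney's model fold is a fold point of `IsFoldPointAt`.
[folklore] -/
theorem isFoldPointAt_modelFold : IsFoldPointAt modelFold 0 := by
  refine ⟨e0, ?_, ?_, ?_⟩
  · intro h
    have := congrArg (fun v : E4 => v 0) h
    simp at this
  · rw [fderiv_modelFold]
    simp [Alin_e0]
  · -- `w ↦ dG(w) e₀` is the linear map `w ↦ (2 w₀) • e₀`, whose derivative at `0` sends `e₀ ↦ 2 • e₀`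
    have hfun : (fun w : E4 => fderiv ℝ modelFold w e0) =
        fun w => ((2 : ℝ) • p0).smulRight e0 w := by
      funext w
      rw [fderiv_modelFold]
      simp [Alin_e0, ContinuousLinearMap.smulRight_apply, two_smul, add_smul]
    rw [hfun, ContinuousLinearMap.fderiv, fderiv_modelFold]
    rintro ⟨h, hh⟩
    have := congrArg (fun v : E4 => v 0) hh
    simp [Alin, e0] at this

end ModelFold

end Summit.SmoothPoincare4.SmoothPoincare4.Cruxes.OrigamiFoldExistence.ShadowPleats

end
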